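import Summits.PneNP.PneNP.Theorems.ExpanderLinearGeneratorsDepthSevenNodes
import Summits.PneNP.PneNP.Theorems.ExpanderLinearGeneratorsLinearGeneratorDepthFregeHardDepthFloor
import Summits.PneNP.PneNP.Theorems.ExpanderLinearGeneratorsLinearGeneratorDepthFregeHardLocalityEight
import Summits.PneNP.PneNP.Theorems.ExpanderLinearGeneratorsLinearGeneratorDepthFregeHardInstances

/-!
# PneNP / ExpanderLinearGenerators — every unsatisfiable CNF has a depth-`7` `textbookFrege`
refutation: the depth threshold of the Frege rungs is exact (stmt-PneNP-11442 / 11443 / 11444)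

Route `PneNP/ExpanderLinearGenerators`. The three lower-bound rungs
(`ExpansionForcesDepthFregeSize`, `LinearGeneratorDepthFregeHard` = Krajíček's Problem 19.4.5,
`LinearGeneratorModPFregeHard`) conclude a size lower bound for every depth-`d` `textbookFrege`
(resp. `textbookFrege(MOD_p)`) proof `π` of `¬ ofCNF (sumEncoding 1 E)`. Two sibling files pin
the depth parameter: NO such `π` exists when `d ≤ 6` (`seven_le_of_isDepthProofOf_neg_ofCNF`,
`not_isDepthProofOf_of_le_six`: every proof contains the `∧`-axiom at the first clause, a line of
alternation depth `7`), and one exists when `d ≥ 30` (`exists_isDepthProofOf_neg_ofCNF`, the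
brute-force tree run through a generic sequent toolkit with overhead `26`). This file closes the
gap:

* `exists_isDepthProofOf_seven_neg_ofCNF` — **every unsatisfiable CNF `φ` over `ℕ` has a
  `textbookFrege` proof of `¬ ofCNF φ` all of whose lines have alternation depth `≤ 7`.**

So the depth threshold of all three rungs is EXACT: they are vacuous for `d ≤ 6` and quantify
over a nonempty set of proofs for every `d ≥ 7` — corollaries at the end: for every `ℓ ≥ 9`,
every `δ > 0` and every `d ≥ 7` the full hypothesis set of `LinearGeneratorDepthFregeHard` /
`LinearGeneratorModPFregeHard` is inhabited on all large `n` (instances of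
`…LinearGeneratorDepthFregeHardInstances`), and that of `ExpansionForcesDepthFregeSize` at every
scale `r`. Together with the locality floor (`…LocalityEight`: vacuous for `ℓ ≤ 8`) both
thresholds `ℓ = 9`, `d = 7` of the cruxes are now exact:
`linearGeneratorDepthFregeHard_hypotheses_eventually_inhabited_iff` — the hypothesis set of
crux 3 at `(ℓ, d, δ)` is inhabited for all large `n` iff `ℓ ≥ 9 ∧ d ≥ 7`.

The construction (this file and `…DepthSevenNodes`, on the toolkit `…DepthSevenToolkit`) is the
brute-force decision tree, budgeted line by line (disjunct depth `dd ≤ 6` throughout, via the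
size-free rules `DD.*` for the predicate `∃ B ℓ, BD 6 B ℓ φ`):
(1) `conjExtract` — `⊢ ¬⋀M ∨ A` for a member `A` of a list conjunction of clause formulas, using
the `∧`-axiom only at the spine pairs `(X, ⋀M')` (its second disjunct `¬(¬X ∨ ¬⋀M')` has `dd = 6`,
the one tight line) and `¬¬`-introduction on `¬X ∨ ¬⋀M'`;
(2) node formulas `g₁ ∨ (g₂ ∨ ⋯ (g_k ∨ ¬Φ))` (falsified literals first, the target LAST, no `⊥`
terminator), for which branching is a bare cut + contraction and member introduction costs
`dd ≤ 6` because the only deep member `¬Φ` (`dd = 4`) is a negation (`dd ¬¬Φ = 4`);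
(3) leaves: `⊢ ¬Φ ∨ C` for the falsified clause `C` (step 1), then the literals of `C` and its
trailing `⊥` are absorbed into the node formula by cuts against member introductions.

References: J. Krajíček, *Bounded arithmetic, propositional logic, and complexity theory*
(CUP 1995), §4.3 (every tautology has a bounded-depth brute-force Frege proof); J. R. Shoenfield,
*Mathematical Logic* (1967), §3.1; J. Krajíček, *Proof complexity* (CUP 2019), Problem 19.4.5.
The statements are folklore; the exact constant `7` refers to the tree's `textbookFrege` and
`PropForm.altDepth`.
-/

namespace Summit.PneNP.PneNP.Theorems

set_option linter.dupNamespace false -- `Summit.PneNP.PneNP.…`: summit = sub-problem (D-0017)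

open Literature.Computability.Complexity Literature.Computability.Complexity.PropForm
open Literature.Computability.MetaComplexity Literature.Computability.MetaComplexity.TextbookFrege
open Literature.Computability.MetaComplexity.KEval (litForm clauseForm clauseForm_cons ofCNF_cons)

/-! ### The decision tree -/

section Tree

variable {φ : CNF ℕ}

/-- `dd ¬(ofCNF φ) ≤ 4`. [folklore] -/
theorem dd_neg_ofCNF_le (φ : CNF ℕ) : (neg (ofCNF φ)).dd ≤ 4 :=
  (dd_le_altDepth _).trans (altDepth_neg_ofCNF_le φ)

/-- `⊢ ¬(ofCNF φ) ∨ C` for every clause `C` of `φ`, at disjunct depth `6`. [folklore] -/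
theorem depthDer_neg_ofCNF_disj_clause {c : Clause ℕ} (hc : c ∈ φ) :
    ∃ B ℓ, BD 6 B ℓ (disj (neg (ofCNF φ)) (clauseForm c)) := by
  rw [ofCNF_eq_conjList]
  refine conjExtract ?_ (List.mem_map_of_mem hc)
  intro Y hY
  obtain ⟨c', -, rfl⟩ := List.mem_map.1 hY
  exact dd_clauseForm_le c'

/-- **Leaf.** If the total assignment `ρ` falsifies `φ` and `Done` contains all variables of `φ`,
the node formula of `(Done, ρ)` has a derivation at disjunct depth `6`: some clause is falsified,
and all its literals occur among the node's literals. [Krajíček 1995, §4.3] [folklore] -/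
theorem depthDer_leaf (Done : List ℕ) (ρ : ℕ → Bool) (hρ : φ.eval ρ = false)
    (hcov : ∀ c ∈ φ, ∀ l ∈ c, l.1 ∈ Done) :
    ∃ B ℓ, BD 6 B ℓ ((Done.map fun x => litForm (x, !ρ x)).foldr disj (neg (ofCNF φ))) := by
  -- a falsified clause
  obtain ⟨c, hcφ, hc⟩ : ∃ c ∈ φ, c.eval ρ = false := by
    by_contra h
    have hall : φ.eval ρ = true := (CNF.eval_eq_true_iff φ ρ).2 fun c hc => by
      cases hce : c.eval ρ
      · exact absurd ⟨c, hc, hce⟩ h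
      · rfl
    rw [hρ] at hall
    exact Bool.false_ne_true hall
  -- its literals are among the node's literals
  have hlit : ∀ l ∈ c, litForm l ∈ Done.map fun x => litForm (x, !ρ x) := by
    intro l hl
    have hfalse : Literal.eval ρ l = false := by
      have : c.any (Literal.eval ρ) = false := hc
      exact List.any_eq_false.1 this l hl |> Bool.eq_false_iff.2
    have hpol : l.2 = !ρ l.1 := by
      unfold Literal.eval at hfalse
      cases h1 : ρ l.1 <;> cases h2 : l.2 <;> simp_all
    refine List.mem_map.2 ⟨l.1, hcov c hcφ l hl, ?_⟩
    rw [← hpol]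
  refine leaf_of_clause (dd_neg_ofCNF_le φ) ?_ hlit (depthDer_neg_ofCNF_disj_clause hcφ)
  intro g hg
  obtain ⟨x, -, rfl⟩ := List.mem_map.1 hg
  exact dd_litForm_le _

/-- **Decision tree.** For every list `W` of variables still to be queried (the variables of `φ`
being among `Done ++ W`, no repetitions) and every assignment `ρ` of the queried ones, the node
formula of `(Done, ρ)` is derivable at disjunct depth `6`: query the next variable `x`, obtain
`x ∨ N` and `¬x ∨ N` from the two extensions of `ρ`, cut and contract — no axiom is spent on
branching. [Krajíček 1995, §4.3 (brute-force bounded-depth proofs)] [folklore] -/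
theorem depthDer_tree (hφ : ¬ φ.Satisfiable) :
    ∀ (W Done : List ℕ) (ρ : ℕ → Bool), (Done ++ W).Nodup → (∀ c ∈ φ, ∀ l ∈ c, l.1 ∈ Done ++ W) →
      ∃ B ℓ, BD 6 B ℓ ((Done.map fun x => litForm (x, !ρ x)).foldr disj (neg (ofCNF φ)))
  | [], Done, ρ, _, hcov => by
    have hρ : φ.eval ρ = false := by
      cases h : φ.eval ρ
      · rfl
      · exact absurd ⟨ρ, h⟩ hφ
    exact depthDer_leaf Done ρ hρ (by simpa using hcov)
  | x :: W, Done, ρ, hnd, hcov => by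
    have hx : x ∉ Done := by
      intro hx
      rw [List.nodup_append] at hnd
      exact hnd.2.2 x hx x List.mem_cons_self rfl
    have hperm : (Done ++ x :: W).Perm (x :: Done ++ W) := List.perm_middle
    have hnd' : (x :: Done ++ W).Nodup := hperm.nodup_iff.1 hnd
    have hcov' : ∀ c ∈ φ, ∀ l ∈ c, l.1 ∈ x :: Done ++ W := fun c hc l hl =>
      hperm.mem_iff.1 (hcov c hc l hl)
    -- the two sons
    have son : ∀ b : Bool, ∃ B ℓ, BD 6 B ℓ (disj (litForm (x, !b))
        ((Done.map fun y => litForm (y, !ρ y)).foldr disj (neg (ofCNF φ)))) := by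
      intro b
      have h := depthDer_tree hφ W (x :: Done) (Function.update ρ x b) hnd' hcov'
      have hmap : (x :: Done).map (fun y => litForm (y, !(Function.update ρ x b y))) =
          litForm (x, !b) :: Done.map fun y => litForm (y, !ρ y) := by
        rw [List.map_cons, Function.update_self]
        congr 1
        refine List.map_congr_left fun y hy => ?_
        rw [Function.update_of_ne (ne_of_mem_of_not_mem hy hx)]
      rwa [hmap, nodeForm_cons] at h
    have h₀ := son false
    have h₁ := son true
    have e₀ : litForm (x, !false) = PropForm.var x := rfl
    have e₁ : litForm (x, !true) = PropForm.neg (PropForm.var x) := rfl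
    rw [e₀] at h₀
    rw [e₁] at h₁
    exact DD.cutContr h₀ h₁

end Tree

/-! ### Refutation completeness at depth `7`, and exactness of the threshold -/

/-- **Every unsatisfiable CNF has a depth-`7` `textbookFrege` refutation**: if `φ : CNF ℕ` is
unsatisfiable then `¬ ofCNF φ` has a `textbookFrege`-proof all of whose lines have alternation
depth `≤ 7`. (The tree has `7` from the other side: `seven_le_of_isDepthProofOf_neg_ofCNF`.)
[Krajíček 1995, §4.3–4.4; Shoenfield 1967, §3.1] [folklore] -/
theorem exists_isDepthProofOf_seven_neg_ofCNF {φ : CNF ℕ} (hφ : ¬ φ.Satisfiable) :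
    ∃ π, textbookFrege.IsDepthProofOf 7 π (neg (ofCNF φ)) := by
  have h := depthDer_tree hφ (List.range φ.numVars) [] (fun _ => false)
    (by simpa using List.nodup_range)
    (fun c hc l hl => by simpa using CNF.lt_numVars_of_mem_of_mem hc hl)
  rw [List.map_nil, nodeForm_nil] at h
  exact DD.exists_isDepthProofOf h

/-- Monotone form: depth-`d` refutations exist for every `d ≥ 7`. [folklore] -/
theorem exists_isDepthProofOf_neg_ofCNF_of_seven_le {φ : CNF ℕ} (hφ : ¬ φ.Satisfiable) {d : ℕ}
    (hd : 7 ≤ d) : ∃ π, textbookFrege.IsDepthProofOf d π (neg (ofCNF φ)) := by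
  obtain ⟨π, hπ, hdepth⟩ := exists_isDepthProofOf_seven_neg_ofCNF hφ
  exact ⟨π, hπ, fun ψ hψ => (hdepth ψ hψ).trans hd⟩

/-- **The depth threshold is exact.** For an unsatisfiable CNF with a negative literal beyond its
first clause (as every XOR-CNF `sumEncoding 1 E` of a system with two nonempty rows has), a
depth-`d` `textbookFrege` proof of `¬ ofCNF φ` exists if and only if `d ≥ 7`. [folklore] -/
theorem exists_isDepthProofOf_neg_ofCNF_iff {C : Clause ℕ} {φ : CNF ℕ}
    (hφ : ¬ CNF.Satisfiable (C :: φ)) (hneg : ∃ D ∈ φ, ∃ l ∈ D, l.2 = false) {d : ℕ} :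
    (∃ π, textbookFrege.IsDepthProofOf d π (neg (ofCNF (C :: φ)))) ↔ 7 ≤ d :=
  ⟨fun ⟨_, hπ⟩ => seven_le_of_isDepthProofOf_neg_ofCNF hneg hπ,
    exists_isDepthProofOf_neg_ofCNF_of_seven_le hφ⟩

/-- The same refutation read in `textbookFrege(MOD_a)` (no `MOD_a` axiom used): every
unsatisfiable CNF has a depth-`d` `F(MOD_a)`-proof of `ofPropForm (¬ ofCNF φ)` for all `d ≥ 7`.
[Buss–Impagliazzo–Krajíček–Pudlák–Razborov–Sgall 1997, Def. 1.1 (`F ⊆ F(MOD_a)`)] [folklore] -/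
theorem exists_isModDepthProofOf_neg_ofCNF_of_seven_le {a : ℕ} {φ : CNF ℕ} (hφ : ¬ φ.Satisfiable)
    {d : ℕ} (hd : 7 ≤ d) :
    ∃ π : List (PropFormMod a ℕ), textbookFrege.IsModDepthProofOf d π
      (PropFormMod.ofPropForm (neg (ofCNF φ))) := by
  obtain ⟨π, hπ⟩ := exists_isDepthProofOf_neg_ofCNF_of_seven_le hφ hd
  exact ⟨_, hπ.isModDepthProofOf_map⟩

/-- **Depth-`d` refutations of unsolvable XOR systems exist for every `d ≥ 7`.** For every
unsolvable system `E` over `𝔽₂` and `d ≥ 7` there is a depth-`d` `textbookFrege` proof of the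
common target `¬ ofCNF (sumEncoding 1 E)` of the three Frege rungs of the route.
[Krajíček 2019, Problem 19.4.5; Beck 2017, Def. 5.6 (`sumEncoding`)] [folklore] -/
theorem exists_isDepthProofOf_sumEncoding_of_seven_le {m n : ℕ} (E : Fin m → LinEqMod 2 n)
    (hE : ¬ SystemSat E Finset.univ) {d : ℕ} (hd : 7 ≤ d) :
    ∃ π, textbookFrege.IsDepthProofOf d π (neg (ofCNF (sumEncoding 1 E))) := by
  refine exists_isDepthProofOf_neg_ofCNF_of_seven_le (fun hsat => hE ?_) hd
  exact (sumEncoding_satisfiable_iff (p := 2) (B := 1) (by norm_num) (by norm_num) E).1 hsat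

/-- The `textbookFrege(MOD_p)` form (rung `LinearGeneratorModPFregeHard`, stmt-PneNP-11444): for
every unsolvable `E` over `𝔽₂`, every modulus `p` and every `d ≥ 7` there is a depth-`d`
`F(MOD_p)`-proof of `ofPropForm (¬ ofCNF (sumEncoding 1 E))`. [Krajíček 2019, Problem 15.6.1]
[folklore] -/
theorem exists_isModDepthProofOf_sumEncoding_of_seven_le (p : ℕ) {m n : ℕ}
    (E : Fin m → LinEqMod 2 n) (hE : ¬ SystemSat E Finset.univ) {d : ℕ} (hd : 7 ≤ d) :
    ∃ π : List (PropFormMod p ℕ), textbookFrege.IsModDepthProofOf d π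
      (PropFormMod.ofPropForm (neg (ofCNF (sumEncoding 1 E)))) := by
  refine exists_isModDepthProofOf_neg_ofCNF_of_seven_le (fun hsat => hE ?_) hd
  exact (sumEncoding_satisfiable_iff (p := 2) (B := 1) (by norm_num) (by norm_num) E).1 hsat


/-! ### The rungs are exercised from depth `7` on -/

/-- **Crux 3 (`LinearGeneratorDepthFregeHard`, stmt-PneNP-11443) is exercised for every `ℓ ≥ 9`,
`d ≥ 7`, `δ > 0`.** For all large `n` there are an `ℓ`-sparse unsolvable system `E` on `n`
variables with `m ≤ n` rows whose supports form an `(n^(1-δ), 3ℓ/4)`-boundary expander AND a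
depth-`d` `textbookFrege` proof of `¬ ofCNF (sumEncoding 1 E)`. With the floors (`ℓ ≤ 8` or
`d ≤ 6` vacuous) the thresholds `ℓ = 9`, `d = 7` of the crux are exact.
[Krajíček 2019, Problem 19.4.5; Krajíček 1995, §4.3] [folklore] -/
theorem linearGeneratorDepthFregeHard_instances_with_proofs_of_seven_le {ℓ d : ℕ} (hℓ : 9 ≤ ℓ)
    (hd : 7 ≤ d) {δ : ℝ} (hδ : 0 < δ) :
    ∃ N₀ : ℕ, ∀ n : ℕ, N₀ ≤ n → ∃ m : ℕ, m ≤ n ∧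
      ∃ (E : Fin m → LinEqMod 2 n) (π : List (PropForm ℕ)),
        (∀ i, (E i).supp.card ≤ ℓ) ∧
        IsBoundaryExpander (fun i => (E i).supp.map Fin.valEmbedding) ((n : ℝ) ^ (1 - δ))
          (3 / 4 * ℓ) ∧
        ¬ SystemSat E Finset.univ ∧
        textbookFrege.IsDepthProofOf d π (neg (ofCNF (sumEncoding 1 E))) := by
  obtain ⟨N₀, hN₀⟩ := linearGeneratorDepthFregeHard_instances hℓ hδ
  refine ⟨N₀, fun n hn => ?_⟩
  obtain ⟨m, hm, E, hsupp, hexp, hunsat⟩ := hN₀ n hn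
  obtain ⟨π, hπ⟩ := exists_isDepthProofOf_sumEncoding_of_seven_le E hunsat hd
  exact ⟨m, hm, E, π, hsupp, hexp, hunsat, hπ⟩

/-- **Crux 4 (`LinearGeneratorModPFregeHard`, stmt-PneNP-11444) is exercised for every modulus
`p`, every `ℓ ≥ 9`, `d ≥ 7`, `δ > 0`**: the same systems, with a depth-`d` `textbookFrege(MOD_p)`
proof of `ofPropForm (¬ ofCNF (sumEncoding 1 E))`. [Krajíček 2019, Problem 15.6.1] [folklore] -/
theorem linearGeneratorModPFregeHard_instances_with_proofs_of_seven_le (p : ℕ) {ℓ d : ℕ}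
    (hℓ : 9 ≤ ℓ) (hd : 7 ≤ d) {δ : ℝ} (hδ : 0 < δ) :
    ∃ N₀ : ℕ, ∀ n : ℕ, N₀ ≤ n → ∃ m : ℕ, m ≤ n ∧
      ∃ (E : Fin m → LinEqMod 2 n) (π : List (PropFormMod p ℕ)),
        (∀ i, (E i).supp.card ≤ ℓ) ∧
        IsBoundaryExpander (fun i => (E i).supp.map Fin.valEmbedding) ((n : ℝ) ^ (1 - δ))
          (3 / 4 * ℓ) ∧
        ¬ SystemSat E Finset.univ ∧
        textbookFrege.IsModDepthProofOf d π
          (PropFormMod.ofPropForm (neg (ofCNF (sumEncoding 1 E)))) := by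
  obtain ⟨N₀, hN₀⟩ := linearGeneratorDepthFregeHard_instances hℓ hδ
  refine ⟨N₀, fun n hn => ?_⟩
  obtain ⟨m, hm, E, hsupp, hexp, hunsat⟩ := hN₀ n hn
  obtain ⟨π, hπ⟩ := exists_isModDepthProofOf_sumEncoding_of_seven_le p E hunsat hd
  exact ⟨m, hm, E, π, hsupp, hexp, hunsat, hπ⟩

/-- **Crux 2 (`ExpansionForcesDepthFregeSize`, stmt-PneNP-11442) is exercised at every scale `r`
for every `ℓ ≥ 9`, `d ≥ 7`**: an `ℓ`-sparse unsolvable `(r, 3ℓ/4)`-boundary-expanding system with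
`m = O_ℓ(max r 1)` rows together with a depth-`d` `textbookFrege` proof of its target.
[Krajíček 2019, Problem 19.4.5] [folklore] -/
theorem expansionForcesDepthFregeSize_instances_with_proofs_of_seven_le {ℓ d : ℕ} (hℓ : 9 ≤ ℓ)
    (hd : 7 ≤ d) (r : ℝ) :
    ∃ (n m : ℕ) (E : Fin m → LinEqMod 2 n) (π : List (PropForm ℕ)),
      (m : ℝ) ≤ 256 * (ℓ + 1) * (16 * (ℓ + 1)) ^ 8 * max r 1 ∧
      (∀ i, (E i).supp.card ≤ ℓ) ∧
      IsBoundaryExpander (fun i => (E i).supp.map Fin.valEmbedding) r (3 / 4 * ℓ) ∧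
      ¬ SystemSat E Finset.univ ∧
      textbookFrege.IsDepthProofOf d π (neg (ofCNF (sumEncoding 1 E))) := by
  obtain ⟨n, m, E, hm, -, hsupp, hexp, hunsat⟩ :=
    expansionForcesDepthFregeSize_instances_at_scale hℓ r
  obtain ⟨π, hπ⟩ := exists_isDepthProofOf_sumEncoding_of_seven_le E hunsat hd
  exact ⟨n, m, E, π, hm, hsupp, hexp, hunsat, hπ⟩


/-- **Both thresholds of crux 3 are exact.** For `ℓ ≥ 1` and `0 < δ < 1`, the hypothesis set of
`LinearGeneratorDepthFregeHard` at `(ℓ, d, δ)` — an `ℓ`-sparse system `E` on `n` variables whose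
supports form an `(n^(1-δ), 3ℓ/4)`-boundary expander, unsolvable, together with a depth-`d`
`textbookFrege` proof of `¬ ofCNF (sumEncoding 1 E)` — is inhabited for all large `n` if and
only if `ℓ ≥ 9` and `d ≥ 7` (if: `linearGeneratorDepthFregeHard_instances_with_proofs_of_seven_le`;
only if: for `ℓ ≤ 8` such systems are solvable once `n^(1-δ) ≥ 6 ⌊log₂ n⌋ + 7`,
`systemSat_of_isBoundaryExpander_of_le_eight`, and for `d ≤ 6` no proof exists once
`n^(1-δ) ≥ 2`, `not_isDepthProofOf_of_le_six`). With
`linearGeneratorDepthFregeHard_iff_nine_le_and_seven_le` (the item is equivalent to its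
restriction to `ℓ ≥ 9 ∧ d ≥ 7`): the crux is exactly Krajíček's Problem 19.4.5 at every
`ℓ ≥ 9`, `d ≥ 7`, and nothing else. [Krajíček 2019, Problem 19.4.5] [folklore] -/
theorem linearGeneratorDepthFregeHard_hypotheses_eventually_inhabited_iff {ℓ d : ℕ} (hℓ : 1 ≤ ℓ)
    {δ : ℝ} (hδ0 : 0 < δ) (hδ1 : δ < 1) :
    (∃ N₀ : ℕ, ∀ n : ℕ, N₀ ≤ n →
      ∃ (m : ℕ) (E : Fin m → LinEqMod 2 n) (π : List (PropForm ℕ)),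
        (∀ i, (E i).supp.card ≤ ℓ) ∧
        IsBoundaryExpander (fun i => (E i).supp.map Fin.valEmbedding) ((n : ℝ) ^ (1 - δ))
          (3 / 4 * ℓ) ∧
        ¬ SystemSat E Finset.univ ∧
        textbookFrege.IsDepthProofOf d π (neg (ofCNF (sumEncoding 1 E)))) ↔
    9 ≤ ℓ ∧ 7 ≤ d := by
  constructor
  · rintro ⟨N₀, hN₀⟩
    -- a large `n` beyond all three thresholds
    obtain ⟨N₁, hN₁⟩ := exists_nat_log_threshold (by linarith : 0 < 1 - δ)
    set n : ℕ := max N₀ (max N₁ ⌈(2 : ℝ) ^ (1 / (1 - δ))⌉₊) with hn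
    obtain ⟨m, E, π, hsparse, hexp, hunsat, hπ⟩ := hN₀ n (le_max_left _ _)
    have hn₁ : N₁ ≤ n := le_trans (le_max_left _ _) (le_max_right _ _)
    have hn₂ : ⌈(2 : ℝ) ^ (1 / (1 - δ))⌉₊ ≤ n := le_trans (le_max_right _ _) (le_max_right _ _)
    refine ⟨?_, ?_⟩
    · by_contra hℓ9
      exact hunsat (systemSat_of_isBoundaryExpander_of_le_eight E hℓ (by omega) hsparse
        (Nat.lt_pow_succ_log_self one_lt_two n) (hN₁ n hn₁) hexp)
    · by_contra hd7
      exact not_isDepthProofOf_of_le_six E hℓ (two_le_rpow_of_ceil_le hδ1 hn₂) (by omega)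
        hsparse hexp hunsat π hπ
  · rintro ⟨hℓ9, hd7⟩
    obtain ⟨N₀, hN₀⟩ := linearGeneratorDepthFregeHard_instances_with_proofs_of_seven_le hℓ9 hd7 hδ0
    refine ⟨N₀, fun n hn => ?_⟩
    obtain ⟨m, -, E, π, h⟩ := hN₀ n hn
    exact ⟨m, E, π, h⟩

end Summit.PneNP.PneNP.Theorems
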